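import Mathlib
import Summits.Ventures.PercRepro2.HCovFns
import Summits.Ventures.PercRepro2.DisagreementPinned

/-!
# b-surgery on a fibre (blind cell PercRepro2, mine-2 g37, 2026-08-28; `proofs/MINE2-FIBRE.md` §1)

The connectivity lemmas behind the b-transfer rule of the typed equality locus
(`TypedFibreTransfer.lean`): `closeAt b ω` closes the edges at `b`; if every open edge at `b` leads to
a vertex joined to one vertex `r` by a path avoiding `b`'s edges, then `b`'s edges are redundant for
the connectivity of the other vertices (`conn_iff_closeAt`, from the closure lemma
`mem_of_conn_of_closed`); a vertex reached from `b` is reached through an open edge at `b`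
(`conn_b_imp`); in a copy with `Q` whose open edges at `b` lead to root-attached vertices, they all
lead to the same root (`one_side`) and `b`'s side is read off its open edges (`conn_b_iff`).

Own code; standard axioms.
-/

namespace Summit.Ventures.PercRepro2

open UnionCluster

namespace CovForm

namespace FibreTransfer

/-! ## b-surgery -/

section Surgery

variable {V : Type*} {E : Type*} [DecidableEq V]
variable (ends : E → Sym2 V)

/-- The configuration with every edge at `b` closed. -/
def closeAt (b : V) (ω : Config E) : Config E := fun e => if b ∈ ends e then false else ω e

/-- `closeAt` leaves the edges not at `b` alone. -/
lemma closeAt_of_notMem {b : V} {ω : Config E} {e : E} (h : b ∉ ends e) :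
    closeAt ends b ω e = ω e := by
  simp [closeAt, h]

/-- `closeAt` closes the edges at `b`. -/
lemma closeAt_of_mem {b : V} {ω : Config E} {e : E} (h : b ∈ ends e) :
    closeAt ends b ω e = false := by
  simp [closeAt, h]

/-- `closeAt b ω ≤ ω`. -/
lemma closeAt_le (b : V) (ω : Config E) : closeAt ends b ω ≤ ω := by
  intro e
  by_cases h : b ∈ ends e
  · rw [closeAt_of_mem ends h]; exact Bool.false_le _
  · rw [closeAt_of_notMem ends h]

/-- Two configurations agreeing off the edges at `b` have the same `closeAt`. -/
lemma closeAt_eq_of_agree {b : V} {ω ω' : Config E} (h : ∀ e, b ∉ ends e → ω e = ω' e) :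
    closeAt ends b ω = closeAt ends b ω' := by
  funext e
  by_cases hb : b ∈ ends e
  · rw [closeAt_of_mem ends hb, closeAt_of_mem ends hb]
  · rw [closeAt_of_notMem ends hb, closeAt_of_notMem ends hb, h e hb]

/-- **b-surgery**: if every open edge at `b` leads to a vertex joined to one vertex `r` by a path
avoiding the edges at `b`, then `b`'s edges are redundant for the connectivity of the other vertices. -/
lemma conn_iff_closeAt {b r : V} (ω : Config E)
    (H : ∀ e, ω e = true → ∀ u, ends e = s(b, u) → Conn ends (closeAt ends b ω) u r)
    {u v : V} (hu : u ≠ b) (hv : v ≠ b) :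
    Conn ends ω u v ↔ Conn ends (closeAt ends b ω) u v := by
  constructor
  · intro h
    let T : Set V := {x | (x ≠ b ∧ Conn ends (closeAt ends b ω) u x) ∨
      (x = b ∧ ∃ e, ω e = true ∧ ∃ u', ends e = s(b, u') ∧ Conn ends (closeAt ends b ω) u u')}
    have hT : ∀ x ∈ T, ∀ y, (openGraph ends ω).Adj x y → y ∈ T := by
      intro x hx y hxy
      rw [openGraph_adj] at hxy
      obtain ⟨hne, e, he, hends⟩ := hxy
      by_cases hyb : y = b
      · rcases hx with ⟨hxb, hcx⟩ | ⟨hxb, -⟩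
        · refine Or.inr ⟨hyb, e, he, x, ?_, hcx⟩
          rw [hends, hyb, Sym2.eq_swap]
        · exact absurd (hxb.trans hyb.symm) hne
      · refine Or.inl ⟨hyb, ?_⟩
        rcases hx with ⟨hxb, hcx⟩ | ⟨hxb, e₁, he₁, u', hends₁, hcu'⟩
        · have hbe : b ∉ ends e := by
            rw [hends, Sym2.mem_iff]
            rintro (h | h)
            · exact hxb h.symm
            · exact hyb h.symm
          have he₀ : closeAt ends b ω e = true := by
            rw [closeAt_of_notMem ends hbe]; exact he
          exact conn_trans hcx (conn_of_openAdj ⟨e, he₀, hends⟩)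
        · rw [hxb] at hends
          have h1 : Conn ends (closeAt ends b ω) y r := H e he y hends
          have h2 : Conn ends (closeAt ends b ω) u' r := H e₁ he₁ u' hends₁
          exact conn_trans hcu' (conn_trans h2 (conn_symm h1))
    have hmem := mem_of_conn_of_closed hT (Or.inl ⟨hu, conn_refl ends _ u⟩) h
    rcases hmem with ⟨-, hc⟩ | ⟨hvb, -⟩
    · exact hc
    · exact absurd hvb hv
  · exact conn_mono (closeAt_le ends b ω)

/-- A vertex `r ≠ b` reached from `b` is reached through an open edge at `b`, the rest of the path
avoiding `b`'s edges. -/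
lemma conn_b_imp {b r : V} (ω : Config E) (hr : r ≠ b) (h : Conn ends ω b r) :
    ∃ e, ω e = true ∧ ∃ u, ends e = s(b, u) ∧ Conn ends (closeAt ends b ω) u r := by
  let T : Set V := {x | x = b ∨ ∃ e, ω e = true ∧ ∃ u, ends e = s(b, u) ∧
    Conn ends (closeAt ends b ω) u x}
  have hT : ∀ x ∈ T, ∀ y, (openGraph ends ω).Adj x y → y ∈ T := by
    intro x hx y hxy
    rw [openGraph_adj] at hxy
    obtain ⟨hne, e, he, hends⟩ := hxy
    by_cases hyb : y = b
    · exact Or.inl hyb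
    rcases hx with hxb | ⟨e₁, he₁, u, hends₁, hcu⟩
    · rw [hxb] at hends
      exact Or.inr ⟨e, he, y, hends, conn_refl ends _ y⟩
    · by_cases hxb : x = b
      · rw [hxb] at hends
        exact Or.inr ⟨e, he, y, hends, conn_refl ends _ y⟩
      refine Or.inr ⟨e₁, he₁, u, hends₁, ?_⟩
      have hbe : b ∉ ends e := by
        rw [hends, Sym2.mem_iff]
        rintro (h | h)
        · exact hxb h.symm
        · exact hyb h.symm
      have he₀ : closeAt ends b ω e = true := by
        rw [closeAt_of_notMem ends hbe]; exact he
      exact conn_trans hcu (conn_of_openAdj ⟨e, he₀, hends⟩)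
  have hmem := mem_of_conn_of_closed hT (Or.inl rfl) h
  rcases hmem with hrb | hex
  · exact absurd hrb hr
  · exact hex

end Surgery

/-! ## The fibre: one side, and the side of `b` -/

section Fibre

open Classical

variable {V : Type*} {E : Type*} [DecidableEq V]
variable (ends : E → Sym2 V) (a₁ a₂ b : V) (z : Config E)

omit [DecidableEq V] in
/-- In a copy with `Q` whose open edges at `b` all lead to root-attached vertices, they all lead to the
same root (attachment through the forced-open configuration `z`). -/
lemma one_side (ω : Config E) (hz : z ≤ ω)
    (hopen : ∀ e, ω e = true → ∀ u, ends e = s(b, u) → Conn ends z u a₁ ∨ Conn ends z u a₂)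
    (hQ : ¬ Conn ends ω a₂ a₁) :
    ∃ r, ∀ e, ω e = true → ∀ u, ends e = s(b, u) → Conn ends z u r := by
  by_cases hex : ∃ e, ω e = true ∧ ∃ u, ends e = s(b, u) ∧ Conn ends z u a₁
  · obtain ⟨e, he, u, hends, hu⟩ := hex
    refine ⟨a₁, fun e' he' u' hends' => ?_⟩
    rcases hopen e' he' u' hends' with h | h
    · exact h
    · exfalso
      apply hQ
      have hbu : Conn ends ω b u := conn_of_openAdj ⟨e, he, hends⟩
      have hbu' : Conn ends ω b u' := conn_of_openAdj ⟨e', he', hends'⟩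
      exact conn_trans (conn_symm (conn_mono hz h)) (conn_trans (conn_symm hbu')
        (conn_trans hbu (conn_mono hz hu)))
  · refine ⟨a₂, fun e' he' u' hends' => ?_⟩
    rcases hopen e' he' u' hends' with h | h
    · exact absurd ⟨e', he', u', hends', h⟩ hex
    · exact h

/-- In a copy with `Q`, `b` is joined to the root `r` iff one of its open edges leads to a vertex
attached to `r` by the forced-open edges. -/
lemma conn_b_iff (ω : Config E) (hz : z ≤ closeAt ends b ω)
    (hopen : ∀ e, ω e = true → ∀ u, ends e = s(b, u) → Conn ends z u a₁ ∨ Conn ends z u a₂)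
    (hQ : ¬ Conn ends ω a₂ a₁) {r : V} (hr : r = a₁ ∨ r = a₂) (hrb : r ≠ b) :
    Conn ends ω b r ↔ ∃ e, ω e = true ∧ ∃ u, ends e = s(b, u) ∧ Conn ends z u r := by
  have hzω : z ≤ ω := hz.trans (closeAt_le ends b ω)
  constructor
  · intro h
    obtain ⟨e, he, u, hends, hcu⟩ := conn_b_imp ends ω hrb h
    refine ⟨e, he, u, hends, ?_⟩
    have hcu' : Conn ends ω u r := conn_mono (closeAt_le ends b ω) hcu
    rcases hopen e he u hends with h1 | h2
    · rcases hr with rfl | rfl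
      · exact h1
      · exfalso; exact hQ (conn_trans (conn_symm hcu') (conn_mono hzω h1))
    · rcases hr with rfl | rfl
      · exfalso; exact hQ (conn_trans (conn_symm (conn_mono hzω h2)) hcu')
      · exact h2
  · rintro ⟨e, he, u, hends, hcu⟩
    exact conn_trans (conn_of_openAdj ⟨e, he, hends⟩) (conn_mono hzω hcu)

end Fibre

/-! ## `b`-blind functions and the indicators -/

section Blind

open Classical

variable {V : Type*} {E : Type*} {R : Type*} [Field R]
variable (ends : E → Sym2 V) (a₁ a₂ b : V)

/-- A function of configurations that only sees the connectivity of the vertices other than `b`. -/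
def BBlind (X : Config E → R) : Prop :=
  ∀ ω ω' : Config E, (∀ u v, u ≠ b → v ≠ b → (Conn ends ω u v ↔ Conn ends ω' u v)) → X ω = X ω'

/-- `1_{v ∈ C(a)}` is `b`-blind for `a, v ≠ b`. -/
lemma bblind_iL {a v : V} (ha : a ≠ b) (hv : v ≠ b) : BBlind ends b (iL ends a v : Config E → R) := by
  intro ω ω' h
  simp only [iL, Set.indicator_apply, mem_connEvent, Pi.one_apply, h a v ha hv]

/-- `1_{v ∈ C(a)}` (second root) is `b`-blind for `a, v ≠ b`. -/
lemma bblind_iH {a v : V} (ha : a ≠ b) (hv : v ≠ b) : BBlind ends b (iH ends a v : Config E → R) := by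
  intro ω ω' h
  simp only [iH, Set.indicator_apply, mem_connEvent, Pi.one_apply, h a v ha hv]

/-- Differences of `b`-blind functions are `b`-blind. -/
lemma bblind_sub {X Y : Config E → R} (hX : BBlind ends b X) (hY : BBlind ends b Y) :
    BBlind ends b (fun ω => X ω - Y ω) := fun ω ω' h => by
  simp only [hX ω ω' h, hY ω ω' h]

/-- Sums of `b`-blind functions are `b`-blind. -/
lemma bblind_add {X Y : Config E → R} (hX : BBlind ends b X) (hY : BBlind ends b Y) :
    BBlind ends b (fun ω => X ω + Y ω) := fun ω ω' h => by
  simp only [hX ω ω' h, hY ω ω' h]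

/-- Products of `b`-blind functions are `b`-blind. -/
lemma bblind_mul {X Y : Config E → R} (hX : BBlind ends b X) (hY : BBlind ends b Y) :
    BBlind ends b (fun ω => X ω * Y ω) := fun ω ω' h => by
  simp only [hX ω ω' h, hY ω ω' h]

/-- The side sign of a mark `v ≠ b` is `b`-blind. -/
lemma bblind_sigma {a₁ a₂ v : V} (h1 : a₁ ≠ b) (h2 : a₂ ≠ b) (hv : v ≠ b) :
    BBlind ends b (sigma ends a₁ a₂ v : Config E → R) :=
  bblind_sub ends b (bblind_iL ends b h1 hv) (bblind_iH ends b h2 hv)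

/-- `1_{v ∈ U}` of a mark `v ≠ b` is `b`-blind. -/
lemma bblind_inU {a₁ a₂ v : V} (h1 : a₁ ≠ b) (h2 : a₂ ≠ b) (hv : v ≠ b) :
    BBlind ends b (inU ends a₁ a₂ v : Config E → R) :=
  bblind_add ends b (bblind_iL ends b h1 hv) (bblind_iH ends b h2 hv)

/-- `1_Q` as a decided indicator. -/
lemma iQ_eq_ite (ω : Config E) :
    (iQ ends a₁ a₂ ω : R) = if Conn ends ω a₂ a₁ then 0 else 1 := by
  unfold iQ
  simp only [Set.indicator_apply, mem_avoidAll, Finset.mem_singleton, forall_eq, Pi.one_apply]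
  by_cases h : Conn ends ω a₂ a₁ <;> simp [h]

/-- The side sign of `b` as a difference of decided indicators. -/
lemma sigma_eq_ite (ω : Config E) :
    (sigma ends a₁ a₂ b ω : R) =
      (if Conn ends ω a₁ b then 1 else 0) - (if Conn ends ω a₂ b then 1 else 0) := by
  unfold sigma iL iH
  simp only [Set.indicator_apply, mem_connEvent, Pi.one_apply]

end Blind

end FibreTransfer

end CovForm

end Summit.Ventures.PercRepro2
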